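import Summits.CriticalPhenomena.Ising3DConformalLimit.Theorems.CoerciveSharpnessPhiCoerciveHoleCapacity
import Literature.Probability.LatticeModels.SharpLengthDCPProofs
import HarnessLib

/-!
# Stub `stub_holeCapacityFlux` (line `box-superset`, crux `CoerciveSharpness.PhiCoercive`, stmt-CriticalPhenomena-18196)

The FLUX form of the Lebowitz hole-capacity bound.  Ferromagnetic n.n. Ising model on `ℤ³`, free
b.c., zero field, `β ≥ 0`, `0 ∈ S ⊆ Λ` finite, holes `H = Λ ∖ S`.  With `u_Λ = ⟨σ·σ·⟩^free_Λ`,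
`n_Λ(x) = #{w ∉ Λ : w ∼ x}` and the flux of `Λ` seen from `z`,
`Φ_Λ(z) = β Σ_{x ∈ Λ} n_Λ(x) u_Λ(z, x)` (so that `Φ_Λ(0) = φ_β(Λ) = dcpPhi 3 β Λ`,
Duminil-Copin–Panis 2025, Def. 1.1):

`φ_β(S) ≥ φ_β(Λ) − β Σ_{h ∈ H} n_Λ(h) u_Λ(0, h)
          − β Σ_{h ∈ H} Σ_{y ∼ h, y ∈ Λ} (u_Λ(0, h) Φ_Λ(y) + u_Λ(0, y) Φ_Λ(h))`.

Proof (pure bookkeeping over the landed pointwise bound `stub_holeCapacityPointwise`,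
Glimm–Jaffe 1987, Cor. 4.3.3): (1) `n_S ≥ n_Λ` on `S` and `u_S ≥ 0` (GKS I), so
`φ(S) ≥ β Σ_{x ∈ S} n_Λ(x) u_S(0, x)`; (2) pointwise `u_S(0, x) ≥ u_Λ(0, x) − E(x)` with
`E(x) = β Σ_{h ∈ H} Σ_{y ∼ h, y ∈ Λ} (u_Λ(0,h) u_Λ(y,x) + u_Λ(0,y) u_Λ(h,x))`, multiplied by
`n_Λ(x) ≥ 0` and summed over `S`; (3) `β Σ_{x ∈ S} n_Λ(x) u_Λ(0,x) = φ(Λ) − β Σ_{h ∈ H} n_Λ(h) u_Λ(0,h)`;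
(4) the error sum over `S` is at most the one over `Λ` (all terms `≥ 0`), which after swapping the
order of summation is exactly the `Φ_Λ` expression.
-/

noncomputable section

namespace Summit.CriticalPhenomena.Ising3DConformalLimit.Cruxes.PhiCoercive.BoxSuperset

open scoped BigOperators
open Finset
open Literature.Probability.LatticeModels

/-! ## Finite bookkeeping -/

/-- Moving a sum over a fixed `s` out of a dependent double sum `Σ_{b ∈ t} Σ_{c ∈ r b}`. -/
private theorem sum_sum_sum_comm {α κ γ : Type*} (s : Finset α) (t : Finset κ) (r : κ → Finset γ)
    (f : α → κ → γ → ℝ) :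
    ∑ b ∈ t, ∑ c ∈ r b, ∑ a ∈ s, f a b c = ∑ a ∈ s, ∑ b ∈ t, ∑ c ∈ r b, f a b c := by
  have h : ∀ b ∈ t, ∑ c ∈ r b, ∑ a ∈ s, f a b c = ∑ a ∈ s, ∑ c ∈ r b, f a b c :=
    fun b _ => Finset.sum_comm
  rw [Finset.sum_congr rfl h, Finset.sum_comm]

/-- **The bookkeeping behind the flux form** (abstract version).  `S ⊆ Λ`, `β ≥ 0`, weights
`0 ≤ nΛ ≤ nS` on `S` (`nΛ ≥ 0` on `Λ`), kernels `u ≥ 0` on `Λ × Λ`, `v ≥ 0` on `S`, neighbourhoods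
`N h ⊆ Λ` of the holes, and the pointwise bound
`u o x − v x ≤ β Σ_{h ∈ Λ∖S} Σ_{y ∈ N h} (u o h · u y x + u o y · u h x)` on `S`; then
`β Σ_Λ nΛ·u o − β Σ_{Λ∖S} nΛ·u o − β Σ_{h} Σ_{y} (u o h · Φ y + u o y · Φ h) ≤ β Σ_S nS·v` with
`Φ z = β Σ_{x ∈ Λ} nΛ x · u z x`. -/
private theorem flux_bookkeeping {ι : Type*} [DecidableEq ι] {S Λ : Finset ι} (hSΛ : S ⊆ Λ)
    (N : ι → Finset ι) {β : ℝ} (hβ : 0 ≤ β) (nS nΛ : ι → ℝ) (u : ι → ι → ℝ) (v : ι → ℝ) {o : ι}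
    (ho : o ∈ Λ) (hn : ∀ x ∈ S, nΛ x ≤ nS x) (hnΛ : ∀ x ∈ Λ, 0 ≤ nΛ x) (hv : ∀ x ∈ S, 0 ≤ v x)
    (hu : ∀ a ∈ Λ, ∀ b ∈ Λ, 0 ≤ u a b) (hN : ∀ h ∈ Λ \ S, ∀ y ∈ N h, y ∈ Λ)
    (hpt : ∀ x ∈ S, u o x - v x ≤
      β * ∑ h ∈ Λ \ S, ∑ y ∈ N h, (u o h * u y x + u o y * u h x)) :
    β * ∑ x ∈ Λ, nΛ x * u o x - β * ∑ h ∈ Λ \ S, nΛ h * u o h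
        - β * ∑ h ∈ Λ \ S, ∑ y ∈ N h, (u o h * (β * ∑ x ∈ Λ, nΛ x * u y x) +
            u o y * (β * ∑ x ∈ Λ, nΛ x * u h x))
      ≤ β * ∑ x ∈ S, nS x * v x := by
  -- the pointwise error term `E`
  obtain ⟨E, hE⟩ : ∃ E : ι → ℝ, ∀ x, E x =
      β * ∑ h ∈ Λ \ S, ∑ y ∈ N h, (u o h * u y x + u o y * u h x) := ⟨_, fun _ => rfl⟩
  have hE0 : ∀ x ∈ Λ, 0 ≤ E x := fun x hx => by
    rw [hE]
    refine mul_nonneg hβ (Finset.sum_nonneg fun h hh => Finset.sum_nonneg fun y hy => ?_)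
    have hhΛ : h ∈ Λ := (Finset.mem_sdiff.1 hh).1
    have hyΛ : y ∈ Λ := hN h hh y hy
    exact add_nonneg (mul_nonneg (hu o ho h hhΛ) (hu y hyΛ x hx))
      (mul_nonneg (hu o ho y hyΛ) (hu h hhΛ x hx))
  -- (3) splitting the flux of `Λ` over `S` and the holes
  have hC : β * ∑ x ∈ Λ, nΛ x * u o x - β * ∑ h ∈ Λ \ S, nΛ h * u o h =
      β * ∑ x ∈ S, nΛ x * u o x := by
    rw [← Finset.sum_sdiff hSΛ]
    ring
  -- (4) the total error term, with the `x`-sum outermost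
  have hD : β * ∑ h ∈ Λ \ S, ∑ y ∈ N h, (u o h * (β * ∑ x ∈ Λ, nΛ x * u y x) +
      u o y * (β * ∑ x ∈ Λ, nΛ x * u h x)) = β * ∑ x ∈ Λ, nΛ x * E x := by
    have hinner : ∀ h ∈ Λ \ S, ∑ y ∈ N h, (u o h * (β * ∑ x ∈ Λ, nΛ x * u y x) +
        u o y * (β * ∑ x ∈ Λ, nΛ x * u h x)) =
        ∑ y ∈ N h, ∑ x ∈ Λ, β * (nΛ x * (u o h * u y x + u o y * u h x)) := by
      intro h _
      refine Finset.sum_congr rfl fun y _ => ?_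
      simp only [Finset.mul_sum, ← Finset.sum_add_distrib]
      exact Finset.sum_congr rfl fun x _ => by ring
    have houter : ∀ x ∈ Λ, nΛ x * E x =
        ∑ h ∈ Λ \ S, ∑ y ∈ N h, β * (nΛ x * (u o h * u y x + u o y * u h x)) := by
      intro x _
      simp only [hE, Finset.mul_sum]
      exact Finset.sum_congr rfl fun h _ => Finset.sum_congr rfl fun y _ => by ring
    rw [Finset.sum_congr rfl hinner, Finset.sum_congr rfl houter, sum_sum_sum_comm]
  -- (1) + (2): comparison over `S`
  have hAB : β * ∑ x ∈ S, nΛ x * u o x - β * ∑ x ∈ S, nΛ x * E x ≤ β * ∑ x ∈ S, nS x * v x := by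
    rw [← mul_sub, ← Finset.sum_sub_distrib]
    refine mul_le_mul_of_nonneg_left (Finset.sum_le_sum fun x hx => ?_) hβ
    have hxΛ : x ∈ Λ := hSΛ hx
    have hpx : u o x - v x ≤ E x := by rw [hE]; exact hpt x hx
    have h1 : nΛ x * u o x - nΛ x * E x ≤ nΛ x * v x := by
      rw [← mul_sub]
      exact mul_le_mul_of_nonneg_left (by linarith) (hnΛ x hxΛ)
    exact h1.trans (mul_le_mul_of_nonneg_right (hn x hx) (hv x hx))
  -- (4') extending the error sum from `S` to `Λ`
  have hD' : β * ∑ x ∈ S, nΛ x * E x ≤ β * ∑ x ∈ Λ, nΛ x * E x :=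
    mul_le_mul_of_nonneg_left (Finset.sum_le_sum_of_subset_of_nonneg hSΛ
      fun x hxΛ _ => mul_nonneg (hnΛ x hxΛ) (hE0 x hxΛ)) hβ
  rw [hC, hD]
  linarith

/-! ## The stub -/

/-- **Stub `stub_holeCapacityFlux` (hole capacity, flux form).** Ferromagnetic n.n. Ising model on
`ℤ³`, free b.c., zero field, `β ≥ 0`, `0 ∈ S ⊆ Λ` finite, `H = Λ ∖ S`:
`φ_β(Λ) − β Σ_{h ∈ H} n_Λ(h) ⟨σ₀σ_h⟩_Λ − β Σ_{h ∈ H} Σ_{y ∼ h, y ∈ Λ} (⟨σ₀σ_h⟩_Λ Φ_Λ(y) + ⟨σ₀σ_y⟩_Λ Φ_Λ(h)) ≤ φ_β(S)`,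
where `n_Λ(x) = #{w ∉ Λ : w ∼ x}`, `Φ_Λ(z) = β Σ_{x ∈ Λ} n_Λ(x) ⟨σ_zσ_x⟩_Λ` and `φ_β = dcpPhi 3 β`
(Duminil-Copin–Panis 2025, Def. 1.1).  Bookkeeping over the pointwise Lebowitz hole-capacity bound
`stub_holeCapacityPointwise` (Glimm–Jaffe 1987, Cor. 4.3.3) and GKS I.
[cite: DuminilCopinPanis2025LowerBounds, Def. 1.1] [cite: GlimmJaffe1987, Cor. 4.3.3] -/
theorem stub_holeCapacityFlux : ∀ (β : ℝ), 0 ≤ β → ∀ (S Λ : Finset (Site 3)), S ⊆ Λ → (0 : Site 3) ∈ S →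
    dcpPhi 3 β Λ
      - β * ∑ h ∈ Λ \ S, ((((zdGraph 3).neighborFinset h).filter fun y => y ∉ Λ).card : ℝ) *
          isingTwoPoint (zdGraph 3) Λ β 0 .free 0 h
      - β * ∑ h ∈ Λ \ S, ∑ y ∈ ((zdGraph 3).neighborFinset h).filter (fun y => y ∈ Λ),
          (isingTwoPoint (zdGraph 3) Λ β 0 .free 0 h *
              (β * ∑ x ∈ Λ, ((((zdGraph 3).neighborFinset x).filter fun w => w ∉ Λ).card : ℝ) *
                isingTwoPoint (zdGraph 3) Λ β 0 .free y x) +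
            isingTwoPoint (zdGraph 3) Λ β 0 .free 0 y *
              (β * ∑ x ∈ Λ, ((((zdGraph 3).neighborFinset x).filter fun w => w ∉ Λ).card : ℝ) *
                isingTwoPoint (zdGraph 3) Λ β 0 .free h x))
      ≤ dcpPhi 3 β S := by
  intro β hβ S Λ hSΛ h0
  have hgks : ∀ {Λ A : Finset (Site 3)} {β h : ℝ} {bc : BoundaryCondition (Site 3)},
      gks_one (zdGraph 3) (Λ := Λ) (A := A) (β := β) (h := h) (bc := bc) :=
    GKSInequalities.gks_one_holds (zdGraph 3)
  have h0Λ : (0 : Site 3) ∈ Λ := hSΛ h0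
  -- `n_Λ ≤ n_S` on `S`: a neighbour outside `Λ` is outside `S`
  have hn : ∀ x ∈ S, ((((zdGraph 3).neighborFinset x).filter fun w => w ∉ Λ).card : ℝ) ≤
      ((((zdGraph 3).neighborFinset x).filter fun y => y ∉ S).card : ℝ) := by
    intro x _
    have hsub : (((zdGraph 3).neighborFinset x).filter fun w => w ∉ Λ) ⊆
        (((zdGraph 3).neighborFinset x).filter fun y => y ∉ S) := by
      intro w hw
      rw [Finset.mem_filter] at hw ⊢
      exact ⟨hw.1, fun hwS => hw.2 (hSΛ hwS)⟩
    exact_mod_cast Finset.card_le_card hsub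
  simp only [dcpPhi]
  exact flux_bookkeeping hSΛ (fun h => ((zdGraph 3).neighborFinset h).filter fun y => y ∈ Λ) hβ
    (fun x => ((((zdGraph 3).neighborFinset x).filter fun y => y ∉ S).card : ℝ))
    (fun x => ((((zdGraph 3).neighborFinset x).filter fun w => w ∉ Λ).card : ℝ))
    (fun a b => isingTwoPoint (zdGraph 3) Λ β 0 .free a b)
    (fun x => isingTwoPoint (zdGraph 3) S β 0 .free 0 x) h0Λ hn (fun x _ => by positivity)
    (fun x hx => isingTwoPoint_free_nonneg hgks hβ h0 hx)
    (fun a ha b hb => isingTwoPoint_free_nonneg hgks hβ ha hb)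
    (fun h _ y hy => (Finset.mem_filter.1 hy).2)
    (fun x hx => stub_holeCapacityPointwise β hβ S Λ hSΛ 0 x h0 hx)

end Summit.CriticalPhenomena.Ising3DConformalLimit.Cruxes.PhiCoercive.BoxSuperset

end
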